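import Summits.Ventures.PercRepro.S4MidKeyNineFiftythreeL9C1
import Summits.Ventures.PercRepro.S4MidKeyNineFiftythreeL9C2

/-!
# PercRepro — THE MIDDLE KEY AT LEVEL `9`, RANK `53` (p1 g47, S4 feeder — p9 owns SUBCLAIM-S4; no window claim here)

Part of the middle key at rank `53`, level `9` (n₀ = 487, 9 layers; p1 g47): the certificate of proofs/P1-HYPKEY.md §16 split into a chain of
explicit linear forms by layers and by size so that every `linear_combination` stays under the gate's 600-second verification limit (§16 (e)).
Nothing is claimed below `n₀`. Axioms: standard.
-/

open scoped Matroid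

namespace PercRepro

namespace S4Mid

open Set Finset S2LP S3Mid

variable {α : Type}

set_option maxHeartbeats 64000000 in
set_option maxRecDepth 20000 in
set_option linter.unusedSimpArgs false in
/-- **THE MIDDLE KEY AT RANK `53`, LEVEL `9`** (9 layers = ranks `9 … 18`): `RLS M 53 9` for every `e`-free `M` on `n ≥ 487` points (`d ≥ 434`). -/
theorem c025_core_nine_midkey_fiftythree_l9 (M : Matroid α) [M.Finite] (hn : 487 ≤ M.E.ncard)
    (hfree : ∀ e ∈ M.E, ∃ A ⊆ M.E \ {e}, e ∉ M.closure A ∧ e ∉ M.closure ((M.E \ {e}) \ A)) :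
    ThmN.RLS M 53 9 := by
  classical
  have h319 : ∀ X ⊆ M.E, M.eRk X ≤ ((9 : ℕ) : ℕ∞) → X.ncard ≤ 319 :=
    fun X hX h => ThmN.ncard_le_three_nineteen_of_eRk_le_nine_of_free M hfree X hX (by exact_mod_cast h)
  have hphi : phiK 53 9 = 128137981938631 / 563673 := by
    rw [HypKey.phiK_eq_two_pow_sub 53 9 (by norm_num), Nat.choose_symm_add]
    simp only [Finset.sum_range_succ, Finset.sum_range_zero]
    norm_num [Nat.choose_eq_descFactorial_div_factorial, Nat.descFactorial_succ, Nat.descFactorial_zero, Nat.factorial]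
  have hTop := topCount_le_sum_rkSets_nine (M := M) 53 h319 (by omega)
  have hY := S3LP.yRow (M := M) 9 53
  have hPrev1 := c025_core_nine_midkey_fiftythree_l9_c1 M hn hfree
  have hPrev2 := c025_core_nine_midkey_fiftythree_l9_c2 M hn hfree
  simp only [rminL, Finset.sum_range_succ, Finset.sum_range_zero, Nat.reduceAdd, Nat.reduceSub, Nat.reduceMul, Nat.reduceEqDiff, Nat.reduceLeDiff, ↓reduceIte, zero_add, add_zero, zero_mul, mul_zero, one_mul, mul_one, Nat.add_sub_cancel] at hTop hY
  rw [ThmN.RLS_iff, hphi]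
  qify at hTop hY
  have hn0 : ∀ s : Set (Set α), (0 : ℚ) ≤ (s.ncard : ℚ) := fun s => Nat.cast_nonneg _
  have N : ∀ k r : ℕ, (0 : ℚ) ≤ ((S1.rkSets M k r).ncard : ℚ) := fun k r => hn0 _
  linear_combination (((((128137981938631 / 563673 * hTop + (-1) * hY) + (1 * hPrev1 + (1 * hPrev2 + 1 * hn0 (S1.rankSet M 17)))) + ((1 * hn0 (S1.rankSet M 18) + 1 * hn0 (S1.rankSet M 19)) + (1 * hn0 (S1.rankSet M 20) + (1 * hn0 (S1.rankSet M 21) + 1 * hn0 (S1.rankSet M 22))))) + (((1 * hn0 (S1.rankSet M 23) + 1 * hn0 (S1.rankSet M 24)) + (1 * hn0 (S1.rankSet M 25) + (1 * hn0 (S1.rankSet M 26) + 1 * hn0 (S1.rankSet M 27)))) + ((1 * hn0 (S1.rankSet M 28) + 1 * hn0 (S1.rankSet M 29)) + (1 * hn0 (S1.rankSet M 30) + (1 * hn0 (S1.rankSet M 31) + 1 * hn0 (S1.rankSet M 32)))))) + ((((1 * hn0 (S1.rankSet M 33) + 1 * hn0 (S1.rankSet M 34)) + (1 * hn0 (S1.rankSet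 M 35) + (1 * hn0 (S1.rankSet M 36) + 1 * hn0 (S1.rankSet M 37)))) + ((1 * hn0 (S1.rankSet M 38) + 1 * hn0 (S1.rankSet M 39)) + (1 * hn0 (S1.rankSet M 40) + (1 * hn0 (S1.rankSet M 41) + 1 * hn0 (S1.rankSet M 42))))) + (((1 * hn0 (S1.rankSet M 43) + 1 * hn0 (S1.rankSet M 44)) + (1 * hn0 (S1.rankSet M 45) + (1 * hn0 (S1.rankSet M 46) + 1 * hn0 (S1.rankSet M 47)))) + ((1 * hn0 (S1.rankSet M 48) + 1 * hn0 (S1.rankSet M 49)) + (1 * hn0 (S1.rankSet M 50) + (1 * hn0 (S1.rankSet M 51) + 1 * hn0 (S1.rankSet M 52)))))))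

end S4Mid

end PercRepro
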